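import Summits.AtomisticToContinuum.BoseEinsteinCondensation.Theorems.BECCutLineWeakDisorderWitnessTransferConvergence
import Literature.MathematicalPhysics.QuantumManyBody.GroundStateFeynmanKacProofs
import Literature.MathematicalPhysics.QuantumManyBody.BoseGasHardCoreCriticalDensity
import Literature.Analysis.FunctionSpaces.MixedNormTestDuality
import Mathlib.Analysis.SpecialFunctions.Log.ENNRealLogExp
import HarnessLib

/-!
# Route BECCutLineWeakDisorder — `WitnessTransfer`, IV: truncation of the pair potential and the
lower envelope `‖e^{-TH_N}1‖₂² ≥ c e^{-2E₀T}`

Support file (does not close the item) for item stmt-AtomisticToContinuum-14978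
(`Summit.AtomisticToContinuum.BoseEinsteinCondensation.Theses.BECCutLineWeakDisorder.WitnessTransfer`);
it proves the registered stub `stub_envelope` (C) of line `Sketch`.

The ground-state Feynman–Kac package (`GroundStateFeynmanKac_holds`) is stated for BOUNDED pair
potentials only, while the route works with a general measurable `v : ℝ → [0, ∞]` (hard cores
allowed). The bridge is the monotone truncation `v ∧ k := fun r => min (v r) k`, `k : ℕ`, which is
bounded by `k`, measurable, and increases to `v`.

## Part 1 — truncation (monotone convergence of the Feynman–Kac functional)

* `continuous_expNeg` — `a ↦ e^{-a}` is continuous on `[0, ∞]` (it is `EReal.exp (-a)`);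
* `iSup_interaction_min`, `iSup_pathAction_min`, `tendsto_pathAction_min` — the interaction and
  the action of the truncations increase to those of `v` (monotone convergence in time);
* `tendsto_fkWeight_min` — the Feynman–Kac weights converge for every sample path;
* `tendsto_fkSemigroup_min`, `tendsto_fkSemigroup_min_one` —
  `(e^{-TH_N^{(k)}}g)(X) → (e^{-TH_N}g)(X)` for every `X` (dominated convergence on Wiener space,
  weights `≤ 1`);
* `tendsto_fkNormSq_min_one` — `‖e^{-TH_N^{(k)}}1‖₂² → ‖e^{-TH_N}1‖₂²` (dominated convergence on
  the box, the functional of `1` is at most `𝟙_Λ`).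

## Part 2 — the lower envelope (`stub_envelope`)

For measurable `v`, `L > 0`, `N ≥ 1` and `E₀ = groundStateEnergy v N L < ∞` there is `c > 0` with
`‖e^{-TH_N}1‖₂² ≥ c e^{-2E₀T}` for all `T ≥ 0`:

* `exists_fkSemigroup_one_le_L2_uniform` — the `L² → L^∞` constant `κ` of `e^{-H_N}` at time one
  is ONE finite number for all pair potentials and all boxes (it is the free heat-kernel bound);
* `ofReal_groundState_le` — a Feynman–Kac ground state of a potential `w` is bounded:
  `Ψ₀ ≤ e^{E₀(w)} κ` (eigen-relation at time one and the `L² → L^∞` bound, `‖Ψ₀‖₂ = 1`);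
* `one_le_mul_lintegral_groundState` — hence `1 = ∫Ψ₀² ≤ e^{E₀(w)} κ ∫Ψ₀`;
* `sq_le_fkNormSq_min_one` — for each truncation `v ∧ k` (bounded, so it HAS a ground state
  `Ψ₀⁽ᵏ⁾`, and `E₀(v ∧ k) ≤ E₀(v)`): `(B⁻¹ e^{-E₀(v)T})² ≤ (e^{-E₀(v∧k)T} ∫Ψ₀⁽ᵏ⁾)² ≤
  ‖e^{-TH_N^{(k)}}1‖₂²` with `B = e^{E₀(v)} κ` independent of `k`
  (`sq_exp_mul_lintegral_le_fkNormSq_one`);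
* `stub_envelope` — let `k → ∞` (`tendsto_fkNormSq_min_one`), `c = B⁻²`.

## References

* K. L. Chung, Z. Zhao, *From Brownian Motion to Schrödinger's Equation* (1995), §3.3 (3.34),
  Thm 3.17. [ChungZhao1995]
* B. Simon, *Schrödinger semigroups*, Bull. AMS 7 (1982), §A1 (A7). [Simon1982]
-/

noncomputable section

open MeasureTheory Filter Set Metric
open scoped ENNReal NNReal Topology

namespace Summit.AtomisticToContinuum.BoseEinsteinCondensation.Theorems.CutLineWitness

open Literature.MathematicalPhysics.QuantumManyBody.BoseGas

/-! ### `e^{-·}` on `[0, ∞]` is continuous -/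

/-- `expNeg a = exp (-a)` computed in the extended reals (`-∞ ↦ 0`). [folklore] -/
theorem expNeg_eq_exp_neg (a : ℝ≥0∞) : expNeg a = EReal.exp (-(a : EReal)) := by
  rcases eq_or_ne a ⊤ with rfl | ha
  · simp
  · rw [expNeg, if_neg ha]
    lift a to ℝ≥0 using ha
    rw [EReal.coe_nnreal_eq_coe_real, ← EReal.coe_neg, EReal.exp_coe, ENNReal.coe_toReal]

/-- `a ↦ e^{-a}` is continuous on `[0, ∞]` (at `∞` too, where it vanishes). [folklore] -/
theorem continuous_expNeg : Continuous expNeg := by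
  rw [show expNeg = fun a : ℝ≥0∞ => EReal.exp (-(a : EReal)) from funext expNeg_eq_exp_neg]
  exact ENNReal.continuous_exp.comp (continuous_neg.comp continuous_coe_ennreal_ereal)

/-! ### Monotonicity in the pair potential -/

/-- The interaction `∑_{i<j} v(|xᵢ - xⱼ|)` is monotone in the pair potential. [folklore] -/
theorem interaction_mono_potential {N : ℕ} {v w : ℝ → ℝ≥0∞} (h : ∀ r, v r ≤ w r)
    (X : Config N) : interaction v X ≤ interaction w X :=
  Finset.sum_le_sum fun _ _ => Finset.sum_le_sum fun _ _ => h _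

/-- The action `∫₀ᵀ ∑_{i<j} v(|Bⁱ_s - Bʲ_s|) ds` is monotone in the pair potential. [folklore] -/
theorem pathAction_mono_potential {N : ℕ} {v w : ℝ → ℝ≥0∞} (h : ∀ r, v r ≤ w r) (T : ℝ)
    (X : Config N) (ω : PathSpace N) : pathAction v T X ω ≤ pathAction w T X ω :=
  lintegral_mono fun _ => interaction_mono_potential h _

/-! ### The truncations `v ∧ k ↑ v` -/

/-- The truncation levels are monotone: `k ≤ l → v ∧ k ≤ v ∧ l`. [folklore] -/
theorem monotone_min_natCast (a : ℝ≥0∞) : Monotone fun k : ℕ => min a (k : ℝ≥0∞) :=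
  fun _ _ hkl => min_le_min_left _ (by exact_mod_cast hkl)

/-- The truncation `v ∧ k` is measurable. [folklore] -/
theorem measurable_min_natCast {v : ℝ → ℝ≥0∞} (hv : Measurable v) (k : ℕ) :
    Measurable fun r => min (v r) (k : ℝ≥0∞) :=
  hv.min measurable_const

/-- The truncation `v ∧ k` is bounded by `k`. [folklore] -/
theorem min_natCast_le (v : ℝ → ℝ≥0∞) (k : ℕ) :
    ∃ C : ℝ≥0, ∀ r, min (v r) (k : ℝ≥0∞) ≤ C :=
  ⟨k, fun _ => (min_le_right _ _).trans_eq (ENNReal.coe_natCast k).symm⟩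

/-- **The interactions of the truncations increase to the interaction**:
`⨆ k, ∑_{i<j} (v ∧ k)(|xᵢ - xⱼ|) = ∑_{i<j} v(|xᵢ - xⱼ|)` (finite sums commute with monotone
suprema, and `⨆ k, min a k = a`, the tree's `iSup_min_natCast`). [folklore] -/
theorem iSup_interaction_min {N : ℕ} (v : ℝ → ℝ≥0∞) (X : Config N) :
    ⨆ k : ℕ, interaction (fun r => min (v r) (k : ℝ≥0∞)) X = interaction v X := by
  unfold interaction
  rw [← ENNReal.finsetSum_iSup_of_monotone]
  · refine Finset.sum_congr rfl fun i _ => ?_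
    rw [← ENNReal.finsetSum_iSup_of_monotone]
    · exact Finset.sum_congr rfl fun j _ =>
        Literature.Analysis.FunctionSpaces.iSup_min_natCast _
    · exact fun j => monotone_min_natCast _
  · exact fun i k l hkl => Finset.sum_le_sum fun j _ => monotone_min_natCast _ hkl

/-- The interaction along a sample path is measurable in time. [folklore] -/
theorem measurable_interaction_worldLine {N : ℕ} {v : ℝ → ℝ≥0∞} (hv : Measurable v)
    (X : Config N) (ω : PathSpace N) :
    Measurable fun s : ℝ => interaction v (worldLine X ω s.toNNReal) :=
  (measurable_interaction hv).comp (continuous_worldLine_toNNReal X ω).measurable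

/-- **The actions of the truncations increase to the action**:
`⨆ k, ∫₀ᵀ ∑_{i<j} (v ∧ k) = ∫₀ᵀ ∑_{i<j} v` along every sample path (monotone convergence in
time). [folklore] -/
theorem iSup_pathAction_min {N : ℕ} {v : ℝ → ℝ≥0∞} (hv : Measurable v) (T : ℝ) (X : Config N)
    (ω : PathSpace N) :
    ⨆ k : ℕ, pathAction (fun r => min (v r) (k : ℝ≥0∞)) T X ω = pathAction v T X ω := by
  unfold pathAction
  rw [← lintegral_iSup]
  · exact lintegral_congr fun s => iSup_interaction_min v _
  · exact fun k => measurable_interaction_worldLine (measurable_min_natCast hv k) X ω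
  · exact fun k l hkl s => interaction_mono_potential (fun r => monotone_min_natCast (v r) hkl) _

/-- The actions of the truncations converge to the action, along every sample path. [folklore] -/
theorem tendsto_pathAction_min {N : ℕ} {v : ℝ → ℝ≥0∞} (hv : Measurable v) (T : ℝ)
    (X : Config N) (ω : PathSpace N) :
    Tendsto (fun k : ℕ => pathAction (fun r => min (v r) (k : ℝ≥0∞)) T X ω) atTop
      (𝓝 (pathAction v T X ω)) := by
  rw [← iSup_pathAction_min hv T X ω]
  exact tendsto_atTop_iSup fun k l hkl =>
    pathAction_mono_potential (fun r => monotone_min_natCast (v r) hkl) T X ω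

/-- **The Feynman–Kac weights of the truncations converge to the weight**, for every sample
path (`e^{-·}` is continuous on `[0, ∞]`; the killing indicator does not depend on `v`).
[folklore] -/
theorem tendsto_fkWeight_min {N : ℕ} {v : ℝ → ℝ≥0∞} (hv : Measurable v) (L T : ℝ)
    (X : Config N) (ω : PathSpace N) :
    Tendsto (fun k : ℕ => fkWeight (fun r => min (v r) (k : ℝ≥0∞)) L T X ω) atTop
      (𝓝 (fkWeight v L T X ω)) := by
  unfold fkWeight
  by_cases hω : ω ∈ survives L T X
  · simp only [Set.indicator_of_mem hω]
    exact (continuous_expNeg.tendsto _).comp (tendsto_pathAction_min hv T X ω)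
  · simp only [Set.indicator_of_notMem hω]
    exact tendsto_const_nhds

/-- **The Feynman–Kac functionals of the truncations converge pointwise**:
`(e^{-TH_N^{(k)}} g)(X) → (e^{-TH_N} g)(X)` for measurable `g ≥ 0` with `E[g(B_T)] < ∞`
(dominated convergence on Wiener space: weights `≤ 1`). [folklore] -/
theorem tendsto_fkSemigroup_min {N : ℕ} {v : ℝ → ℝ≥0∞} (hv : Measurable v) (L T : ℝ)
    {g : Config N → ℝ≥0∞} (hg : Measurable g) (X : Config N)
    (hfin : ∫⁻ ω, g (worldLine X ω T.toNNReal) ∂(wienerPaths N) ≠ ⊤) :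
    Tendsto (fun k : ℕ => fkSemigroup (fun r => min (v r) (k : ℝ≥0∞)) L T g X) atTop
      (𝓝 (fkSemigroup v L T g X)) := by
  unfold fkSemigroup
  refine tendsto_lintegral_of_dominated_convergence (fun ω => g (worldLine X ω T.toNNReal))
    (fun k => (measurable_fkWeight (measurable_min_natCast hv k) L T X).mul
      (hg.comp (measurable_worldLine X _)))
    (fun k => Eventually.of_forall fun ω => ?_) hfin ?_
  · calc fkWeight (fun r => min (v r) (k : ℝ≥0∞)) L T X ω * g (worldLine X ω T.toNNReal)
        ≤ 1 * g (worldLine X ω T.toNNReal) := mul_le_mul' (fkWeight_le_one _ L T X ω) le_rfl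
      _ = _ := one_mul _
  · -- `g(B_T) < ∞` almost surely, so the products converge
    filter_upwards [ae_lt_top (hg.comp (measurable_worldLine X _)) hfin] with ω hω
    exact ENNReal.Tendsto.mul_const (tendsto_fkWeight_min hv L T X ω) (Or.inr hω.ne)

/-- In particular `(e^{-TH_N^{(k)}} 1)(X) → (e^{-TH_N} 1)(X)` for every `X`. [folklore] -/
theorem tendsto_fkSemigroup_min_one {N : ℕ} {v : ℝ → ℝ≥0∞} (hv : Measurable v) (L T : ℝ)
    (X : Config N) :
    Tendsto (fun k : ℕ => fkSemigroup (fun r => min (v r) (k : ℝ≥0∞)) L T (fun _ => (1 : ℝ≥0∞)) X)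
      atTop (𝓝 (fkSemigroup v L T (fun _ => (1 : ℝ≥0∞)) X)) := by
  refine tendsto_fkSemigroup_min hv L T measurable_const X ?_
  rw [lintegral_const, measure_univ, mul_one]
  exact ENNReal.one_ne_top

/-- **The squared norms converge**: `‖e^{-TH_N^{(k)}}1‖₂² → ‖e^{-TH_N}1‖₂²` as `k → ∞`, for
`T ≥ 0` (dominated convergence on `(ℝ³)^N` with the dominating function `𝟙_{Λ^N}`: the functional
of `1` is at most `1` and vanishes off the box). [folklore] -/
theorem tendsto_fkNormSq_min_one {N : ℕ} {v : ℝ → ℝ≥0∞} (hv : Measurable v) (L : ℝ) {T : ℝ}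
    (hT : 0 ≤ T) :
    Tendsto (fun k : ℕ => fkNormSq (N := N) (fun r => min (v r) (k : ℝ≥0∞)) L T
      (fun _ => (1 : ℝ≥0∞))) atTop (𝓝 (fkNormSq (N := N) v L T (fun _ => (1 : ℝ≥0∞)))) := by
  simp only [fkNormSq_def]
  refine tendsto_lintegral_of_dominated_convergence ((boxN N L).indicator fun _ => 1)
    (fun k =>
      (measurable_fkSemigroup (measurable_min_natCast hv k) L T measurable_const).pow_const 2)
    (fun k => Eventually.of_forall fun X => ?_) ?_
    (Eventually.of_forall fun X => ENNReal.Tendsto.pow (tendsto_fkSemigroup_min_one hv L T X))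
  · by_cases hX : X ∈ boxN N L
    · rw [Set.indicator_of_mem hX]
      calc fkSemigroup (fun r => min (v r) (k : ℝ≥0∞)) L T (fun _ => (1 : ℝ≥0∞)) X ^ 2
          ≤ 1 ^ 2 := pow_le_pow_left' (fkPartition_le_one _ L T X) 2
        _ = 1 := one_pow 2
    · rw [Set.indicator_of_notMem hX]
      beta_reduce
      rw [fkSemigroup_of_notMem _ hT _ hX]
      simp
  · rw [lintegral_indicator (measurableSet_boxN N L), setLIntegral_const, one_mul]
    exact (volume_boxN_lt_top N L).ne


/-! ### Part 2: the lower envelope -/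

/-- The `L² → L^∞` bound of `e^{-H_N}` at time one holds with ONE finite constant for all pair
potentials `w` and all boxes: `(e^{-H_N}g)(X) ≤ κ ‖g‖₂` (the free heat-kernel bound).
[cite: ChungZhao1995, Thm 3.17] -/
theorem exists_fkSemigroup_one_le_L2_uniform (N : ℕ) :
    ∃ κ : ℝ≥0∞, κ ≠ ⊤ ∧ ∀ (w : ℝ → ℝ≥0∞) (L : ℝ) (g : Config N → ℝ≥0∞), Measurable g →
      ∀ X : Config N, fkSemigroup w L 1 g X ≤ κ * (∫⁻ Y, g Y ^ (2 : ℝ)) ^ (1 / 2 : ℝ) :=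
  ⟨_, l2linf_const_ne_top 1, fun w L _ hg X => fkSemigroup_le_L2 w L one_pos hg X⟩

/-- **A Feynman–Kac ground state is bounded by `e^{E₀} κ`**: from the eigen-relation at time one,
`e^{-E₀}Ψ₀ = e^{-H_N}Ψ₀ ≤ κ‖Ψ₀‖₂ = κ`. [folklore] -/
theorem ofReal_groundState_le {N : ℕ} {w : ℝ → ℝ≥0∞} {L : ℝ} {Ψ₀ : Config N → ℝ}
    (h : IsGroundStateFK w L Ψ₀) {κ : ℝ≥0∞}
    (hκ : ∀ g : Config N → ℝ≥0∞, Measurable g → ∀ X : Config N,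
      fkSemigroup w L 1 g X ≤ κ * (∫⁻ Y, g Y ^ (2 : ℝ)) ^ (1 / 2 : ℝ)) (X : Config N) :
    ENNReal.ofReal (Ψ₀ X) ≤ ENNReal.ofReal (Real.exp (groundStateEnergy w N L).toReal) * κ := by
  have hone : (∫⁻ Y, ENNReal.ofReal (Ψ₀ Y) ^ (2 : ℝ)) = 1 := by
    rw [← h.norm_eq]; exact lintegral_congr fun Y => ENNReal.rpow_two _
  have h1 : ENNReal.ofReal (Real.exp (-((groundStateEnergy w N L).toReal * 1)) * Ψ₀ X) ≤ κ := by
    rw [← h.eigen 1 zero_le_one X]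
    have := hκ _ h.measurable.ennreal_ofReal X
    rwa [hone, ENNReal.one_rpow, mul_one] at this
  calc ENNReal.ofReal (Ψ₀ X) = ENNReal.ofReal (Real.exp (groundStateEnergy w N L).toReal) *
        ENNReal.ofReal (Real.exp (-((groundStateEnergy w N L).toReal * 1)) * Ψ₀ X) := by
        rw [← ENNReal.ofReal_mul (Real.exp_pos _).le, ← mul_assoc, ← Real.exp_add, mul_one,
          add_neg_cancel, Real.exp_zero, one_mul]
    _ ≤ _ := mul_le_mul' le_rfl h1

/-- **Lower bound on the overlap `⟨Ψ₀, 1⟩`**: if `Ψ₀ ≤ B` pointwise then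
`1 = ∫Ψ₀² ≤ B ∫Ψ₀`. [folklore] -/
theorem one_le_mul_lintegral_groundState {N : ℕ} {w : ℝ → ℝ≥0∞} {L : ℝ} {Ψ₀ : Config N → ℝ}
    (h : IsGroundStateFK w L Ψ₀) {B : ℝ≥0∞} (hB : ∀ X, ENNReal.ofReal (Ψ₀ X) ≤ B) :
    1 ≤ B * ∫⁻ Y, ENNReal.ofReal (Ψ₀ Y) := by
  calc (1 : ℝ≥0∞) = ∫⁻ Y, ENNReal.ofReal (Ψ₀ Y) ^ 2 := h.norm_eq.symm
    _ ≤ ∫⁻ Y, B * ENNReal.ofReal (Ψ₀ Y) :=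
        lintegral_mono fun Y => by rw [sq]; exact mul_le_mul' (hB Y) le_rfl
    _ = B * ∫⁻ Y, ENNReal.ofReal (Ψ₀ Y) := lintegral_const_mul _ h.measurable.ennreal_ofReal

/-- **The envelope for each truncation, with a constant independent of the level.** For measurable
`v`, `L > 0`, `N ≥ 1`, `E₀ = groundStateEnergy v N L < ∞`, the uniform `L² → L^∞` constant `κ`,
`B = e^{E₀} κ`, every `k : ℕ` and `T ≥ 0`:
`(B⁻¹ e^{-E₀T})² ≤ ‖e^{-TH_N^{(k)}}1‖₂²`, where `H_N^{(k)}` has the bounded potential `v ∧ k`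
(its Feynman–Kac ground state `Ψ₀⁽ᵏ⁾` exists by `GroundStateFeynmanKac_holds`; `E₀(v ∧ k) ≤ E₀`,
so `Ψ₀⁽ᵏ⁾ ≤ B`, `∫Ψ₀⁽ᵏ⁾ ≥ B⁻¹`, and `‖e^{-TH^{(k)}}1‖₂ ≥ e^{-E₀(v∧k)T}∫Ψ₀⁽ᵏ⁾`).
[cite: Simon1982, §A1 (A7) p. 449] -/
theorem sq_le_fkNormSq_min_one {N : ℕ} {v : ℝ → ℝ≥0∞} (hv : Measurable v) {L : ℝ} (hL : 0 < L)
    (hN : 1 ≤ N) (hE : groundStateEnergy v N L ≠ ⊤) {κ : ℝ≥0∞} (hκt : κ ≠ ⊤)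
    (hκ : ∀ (w : ℝ → ℝ≥0∞) (g : Config N → ℝ≥0∞), Measurable g → ∀ X : Config N,
      fkSemigroup w L 1 g X ≤ κ * (∫⁻ Y, g Y ^ (2 : ℝ)) ^ (1 / 2 : ℝ))
    (k : ℕ) {T : ℝ} (hT : 0 ≤ T) :
    ((ENNReal.ofReal (Real.exp (groundStateEnergy v N L).toReal) * κ)⁻¹ *
        ENNReal.ofReal (Real.exp (-((groundStateEnergy v N L).toReal * T)))) ^ 2 ≤
      fkNormSq (N := N) (fun r => min (v r) (k : ℝ≥0∞)) L T (fun _ => (1 : ℝ≥0∞)) := by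
  set E : ℝ := (groundStateEnergy v N L).toReal with hEdef
  set B : ℝ≥0∞ := ENNReal.ofReal (Real.exp E) * κ with hBdef
  have hBt : B ≠ ⊤ := ENNReal.mul_ne_top ENNReal.ofReal_ne_top hκt
  -- the truncation `v ∧ k` is bounded and measurable, so it has a Feynman–Kac ground state
  obtain ⟨Ψ₀, hΨ, -, -⟩ :=
    GroundStateFeynmanKac_holds N L _ hN hL (measurable_min_natCast hv k) (min_natCast_le v k)
  -- `E₀(v ∧ k) ≤ E₀(v)`
  have hEk : (groundStateEnergy (fun r => min (v r) (k : ℝ≥0∞)) N L).toReal ≤ E :=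
    ENNReal.toReal_mono hE (groundStateEnergy_mono_potential (fun r => min_le_left _ _) N L)
  -- `Ψ₀ ≤ B`, hence `1 ≤ B ∫Ψ₀` and `B⁻¹ ≤ ∫Ψ₀`
  have hsup : ∀ X, ENNReal.ofReal (Ψ₀ X) ≤ B := fun X =>
    (ofReal_groundState_le hΨ (hκ _) X).trans
      (mul_le_mul' (ENNReal.ofReal_le_ofReal (Real.exp_le_exp.2 hEk)) le_rfl)
  have h1 := one_le_mul_lintegral_groundState hΨ hsup
  have hB0 : B ≠ 0 := by
    rintro hB
    rw [hB, zero_mul] at h1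
    exact not_lt.2 h1 zero_lt_one
  have hinv : B⁻¹ ≤ ∫⁻ Y, ENNReal.ofReal (Ψ₀ Y) :=
    calc B⁻¹ = B⁻¹ * 1 := (mul_one _).symm
      _ ≤ B⁻¹ * (B * ∫⁻ Y, ENNReal.ofReal (Ψ₀ Y)) := mul_le_mul' le_rfl h1
      _ = ∫⁻ Y, ENNReal.ofReal (Ψ₀ Y) := by
          rw [← mul_assoc, ENNReal.inv_mul_cancel hB0 hBt, one_mul]
  -- `e^{-E₀(v)T} ≤ e^{-E₀(v ∧ k)T}`
  have hexp : ENNReal.ofReal (Real.exp (-(E * T))) ≤ ENNReal.ofReal (Real.exp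
      (-((groundStateEnergy (fun r => min (v r) (k : ℝ≥0∞)) N L).toReal * T))) :=
    ENNReal.ofReal_le_ofReal (Real.exp_le_exp.2 (neg_le_neg (mul_le_mul_of_nonneg_right hEk hT)))
  calc (B⁻¹ * ENNReal.ofReal (Real.exp (-(E * T)))) ^ 2
      ≤ ((∫⁻ Y, ENNReal.ofReal (Ψ₀ Y)) * ENNReal.ofReal (Real.exp
          (-((groundStateEnergy (fun r => min (v r) (k : ℝ≥0∞)) N L).toReal * T)))) ^ 2 :=
        pow_le_pow_left' (mul_le_mul' hinv hexp) 2
    _ = (ENNReal.ofReal (Real.exp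
          (-((groundStateEnergy (fun r => min (v r) (k : ℝ≥0∞)) N L).toReal * T))) *
          ∫⁻ Y, ENNReal.ofReal (Ψ₀ Y)) ^ 2 := by rw [mul_comm]
    _ ≤ _ := sq_exp_mul_lintegral_le_fkNormSq_one (measurable_min_natCast hv k) hΨ hT

/-- **(C) Lower envelope.** For measurable `v : ℝ → [0,∞]`, `L > 0`, `N ≥ 1` and finite
variational energy `E₀ = groundStateEnergy v N L`, there is `c > 0` with
`Z(T) = ‖e^{-TH}1‖₂² ≥ c e^{-2E₀T}` for all `T ≥ 0` (truncations `min v k`: ground state of the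
bounded potential, `E₀(min v k) ≤ E₀(v)`, `⟨1, Ψ₀⁽ᵏ⁾⟩ ≥ κ⁻¹e^{-E₀}` uniformly, monotone
convergence `Z_{min v k}(T) ↓ Z_v(T)`). [folklore] -/
theorem stub_envelope {N : ℕ} {v : ℝ → ℝ≥0∞} (hv : Measurable v) {L : ℝ} (hL : 0 < L)
    (hN : 1 ≤ N) (hE : groundStateEnergy v N L ≠ ⊤) :
    ∃ c : ℝ, 0 < c ∧ ∀ T : ℝ, 0 ≤ T →
      ENNReal.ofReal (c * Real.exp (-(2 * (groundStateEnergy v N L).toReal * T))) ≤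
        fkNormSq (N := N) v L T (fun _ => 1) := by
  obtain ⟨κ, hκt, hκ⟩ := exists_fkSemigroup_one_le_L2_uniform N
  set E : ℝ := (groundStateEnergy v N L).toReal with hEdef
  set B : ℝ≥0∞ := ENNReal.ofReal (Real.exp E) * κ with hBdef
  have hBt : B ≠ ⊤ := ENNReal.mul_ne_top ENNReal.ofReal_ne_top hκt
  have hk : ∀ (k : ℕ) {T : ℝ}, 0 ≤ T → (B⁻¹ * ENNReal.ofReal (Real.exp (-(E * T)))) ^ 2 ≤
      fkNormSq (N := N) (fun r => min (v r) (k : ℝ≥0∞)) L T (fun _ => (1 : ℝ≥0∞)) :=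
    fun k T hT => sq_le_fkNormSq_min_one hv hL hN hE hκt (fun w => hκ w L) k hT
  -- `B ≠ 0` (from the bound at `k = 0`, `T = 0`: the right-hand side is finite)
  have hB0 : B ≠ 0 := by
    intro hB
    have h0 := hk 0 le_rfl
    rw [hB, ENNReal.inv_zero, mul_zero, neg_zero, Real.exp_zero, ENNReal.ofReal_one,
      ENNReal.top_mul one_ne_zero, ENNReal.top_pow two_ne_zero, top_le_iff] at h0
    exact (ne_top_of_le_ne_top (volume_boxN_lt_top N L).ne (fkNormSq_one_le _ le_rfl)) h0
  refine ⟨B⁻¹.toReal ^ 2, pow_pos (ENNReal.toReal_pos (ENNReal.inv_ne_zero.2 hBt)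
    (ENNReal.inv_ne_top.2 hB0)) 2, fun T hT => ?_⟩
  have heq : ENNReal.ofReal (B⁻¹.toReal ^ 2 * Real.exp (-(2 * E * T))) =
      (B⁻¹ * ENNReal.ofReal (Real.exp (-(E * T)))) ^ 2 := by
    have h2 : Real.exp (-(2 * E * T)) = Real.exp (-(E * T)) ^ 2 := by
      rw [sq, ← Real.exp_add]; ring_nf
    rw [h2, ← mul_pow, ENNReal.ofReal_pow (by positivity), ENNReal.ofReal_mul ENNReal.toReal_nonneg,
      ENNReal.ofReal_toReal (ENNReal.inv_ne_top.2 hB0)]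
  rw [heq]
  exact ge_of_tendsto' (tendsto_fkNormSq_min_one hv L hT) fun k => hk k hT

end Summit.AtomisticToContinuum.BoseEinsteinCondensation.Theorems.CutLineWitness

end
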